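import Mathlib
import Summits.ResolutionOfSingularities.ResolutionOfSingularities.Theorems.RadicialJungCleanModelsCleanProp44NearLineNoTangent
import Summits.ResolutionOfSingularities.ResolutionOfSingularities.Theorems.RadicialJungCleanModelsCleanProp44NearLineLocal
import HarnessLib

/-!
# Route `RadicialJung`, crux `CleanModels` (stmt-ResolutionOfSingularities-15917), line `Sketch` rev 35, stub 6 `stub_cleanProp44` (X44c):
# CLEAN-PERMISSIBILITY OF NEAR LINES, XI — BIRTHS ARE TANGENCY POINTS: the derivation test (abstract chart)

Seat decomp-res-hand-2 g18 (structural hand).  The birth disjunct of ✓ `cleanPermissibleAt_nearLine_or_corner_or_birth` («`Ū ∈ κ(x')^p` and every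
`U - c'^p ∈ 𝔪` lies in `(N + 𝔪²) ∖ N`») is the `W`-TANGENCY of memo 4e §2.4: here is its kernel test, in the abstract chart data of a point blowing up
(`…CleanPointBlowupChart.lean`: `t`, chart `t_j`, `A ⊇ ψ(R)`, `u_i`, `ε : κ[T_i]_{i ≠ j} ≅ A/(ψ t_j)`, `𝔓`, `L = A_𝔓`), near line
`N = (ψ t_j, L_y)` with `L_y = Σ_k ψ(m_k) u_k` (the transform of `y = Σ m_k t_k`):

* `derivation_apply_mul_prod_pow_eq_sum_mul` — the weighted Euler identity `D(x ∏ y_i^{a_i}) = (Σ a_i b_i) · x ∏ y_i^{a_i}` for `D y_i = b_i y_i`, `D x = 0`.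
* `sub_pow_not_mem_map_sup_sq_of_derivation` — the `p`-th power version of ✓ `not_mem_map_sup_sq_of_derivation` (clear denominators as in
  ✓ `stub_leibnizObstruction`): `D(φ K) ⊆ Q`, `D(φ b) ∉ Q` ⟹ `b - c'^p ∉ K O_q + 𝔪²` for EVERY `c' ∈ O_q`.
* `sub_pow_not_mem_nearLine_sup_sq_of_derivation` — on the chart: a derivation `D` of `κ[T]` tangent to the near line at the point (`D L̄_y ∈ Q`)
  and not killing the reduction of `b ∈ A ∖ 𝔓` there (`D b̄ ∉ Q`) forbids the birth: `b - c'^p ∉ N L + 𝔪_L²` for all `c'`.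
* `cleanPermissibleAt_nearLine_of_derivation` — hence (dictionary ✓ `cleanPermissibleAt_of_unit_rep_of_forall/_of_transversal`) the line of
  `f'(b) · d^p` is clean-permissible for `N` (`(ψ t_j, L_y, z')` a regular system, `dim L = 3`).
* `sub_pow_not_mem_nearLine_sup_sq_of_cross` (appended: `…_of_cross'`, the same read in `L`) — THE EXPLICIT TEST for `b = ψ(u) ∏_k u_k^{a_k} ∉ 𝔓` (no side through the point) with the tangent
  derivation `D = m̄_{k₂} T_{k₂} · T_{k₁}∂_{k₁} - m̄_{k₁} T_{k₁} · T_{k₂}∂_{k₂}` (`k₁ ≠ k₂`, both `≠ j`): if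
  `a_{k₁} ψ(m_{k₂}) u_{k₂} - a_{k₂} ψ(m_{k₁}) u_{k₁} ∉ 𝔓` then no birth.  In dimension `3` this confines the births of the near line
  `{m̄_j + m̄_{k₁} T_{k₁} + m̄_{k₂} T_{k₂} = 0}` to its intersection with the line `{a_{k₁} m̄_{k₂} T_{k₂} = a_{k₂} m̄_{k₁} T_{k₁}}` through the vertex
  (memo 4e §2.4 (B2): at most one birth, a `κ(x)`-rational point) — the global count itself needs `E_x ≅ ℙ²` and is not done here.

Honest framing: OURS, elementary; a TOOL for the (R1ᵐⁱⁿ)/(R3ᵐⁱⁿ′) provers.  Nothing here proves X44c, any case of `CleanModels`, or resolution of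
singularities in characteristic `p`.  Setting only: [cite: StacksProject, Tag 07PF] [cite: CossartPiltant2008, Lemma 4.3 (5)] [cite: Piltant2013, §2 Axiom 4].
-/

noncomputable section

set_option linter.dupNamespace false -- mandated namespace of this single-conjunct summit

open IsLocalRing MvPolynomial
open Literature.AlgebraicGeometry.Resolution

namespace Summit.ResolutionOfSingularities.ResolutionOfSingularities.Theorems.RadicialJung.CleanModels

universe u

/-! ## §0 Algebra -/

/-- **Weighted Euler identity**: if `D y_i = b_i · y_i` for all `i` and `D x = 0`, then `D (x ∏ y_i^{a_i}) = (Σ a_i b_i) · x ∏ y_i^{a_i}`. [folklore] -/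
theorem derivation_apply_mul_prod_pow_eq_sum_mul {E : Type*} [CommRing E] (D : Derivation ℤ E E) {m : ℕ} (y : Fin m → E) (b : Fin m → E)
    (a : Fin m → ℕ) (hy : ∀ i, D (y i) = b i * y i) {x : E} (hx : D x = 0) :
    D (x * ∏ i, y i ^ a i) = (∑ i, (a i : E) * b i) * (x * ∏ i, y i ^ a i) := by
  classical
  have key : ∀ s : Finset (Fin m), D (∏ i ∈ s, y i ^ a i) = (∑ i ∈ s, (a i : E) * b i) * ∏ i ∈ s, y i ^ a i := by
    intro s
    induction s using Finset.induction_on with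
    | empty => simp
    | insert i s hi ih =>
      rw [Finset.prod_insert hi, Finset.sum_insert hi, Derivation.leibniz, ih, Derivation.leibniz_pow, hy i, smul_eq_mul, smul_eq_mul]
      rcases Nat.eq_zero_or_pos (a i) with h0 | hpos
      · rw [h0]; simp
      · simp only [smul_eq_mul, nsmul_eq_mul]
        have h1 : (y i ^ (a i - 1) * (b i * y i) : E) = b i * y i ^ a i := by
          rw [mul_comm (b i), ← mul_assoc, ← pow_succ, Nat.sub_add_cancel hpos, mul_comm]
        rw [h1]
        ring
  rw [Derivation.leibniz, hx, smul_zero, add_zero, key Finset.univ, smul_eq_mul]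
  ring

/-- **The derivation obstruction relative to an ideal, `p`-th power version** (✓ `not_mem_map_sup_sq_of_derivation` + clearing denominators as in
✓ `stub_leibnizObstruction`): with `φ : O → E` into characteristic `p`, primes `Q ∩ O = q`, `K ≤ q` with `D(φ K) ⊆ Q` and `b ∈ O` with `D(φ b) ∉ Q`,
for EVERY `c' ∈ O_q` the element `b - c'^p` does not lie in `K O_q + 𝔪_{O_q}²`. [cite: StacksProject, Tag 07PF] -/
theorem sub_pow_not_mem_map_sup_sq_of_derivation {O E : Type*} [CommRing O] [CommRing E] (φ : O →+* E) (p : ℕ) [hp : Fact p.Prime] [CharP E p]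
    (q : Ideal O) [q.IsPrime] (Q : Ideal E) [Q.IsPrime] (hQ : Q.comap φ = q) (D : Derivation ℤ E E) (K : Ideal O) (hKq : K ≤ q)
    (hK : ∀ k ∈ K, D (φ k) ∈ Q) (b : O) (hb : D (φ b) ∉ Q) {O' : Type*} [CommRing O'] [IsLocalRing O'] [Algebra O O']
    [IsLocalization.AtPrime O' q] (c' : O') :
    algebraMap O O' b - c' ^ p ∉ K.map (algebraMap O O') ⊔ maximalIdeal O' ^ 2 := by
  intro h
  have hφ : ∀ x : O, φ x ∈ Q ↔ x ∈ q := fun x => by rw [← hQ, Ideal.mem_comap]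
  -- `c' = a / s`, `g = s^p b - a^p`
  obtain ⟨a, s, rfl⟩ := IsLocalization.exists_mk'_eq q.primeCompl c'
  have hkey : algebraMap O O' ((s : O) ^ p * b - a ^ p) =
      algebraMap O O' s ^ p * (algebraMap O O' b - IsLocalization.mk' O' a s ^ p) := by
    rw [map_sub, map_mul, map_pow, map_pow, mul_sub, ← mul_pow, IsLocalization.mk'_spec' O' a s]
  -- `D(φ g) = φ(s)^p D(φ b) ∉ Q`
  have hDg : D (φ ((s : O) ^ p * b - a ^ p)) ∉ Q := by
    have h1 : D (φ ((s : O) ^ p * b - a ^ p)) = φ s ^ p * D (φ b) := by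
      rw [map_sub, map_mul, map_pow, map_pow, map_sub, Derivation.leibniz, derivation_apply_pow_charP p D, derivation_apply_pow_charP p D,
        smul_zero, add_zero, sub_zero, smul_eq_mul]
    rw [h1]
    intro h2
    rcases ‹Q.IsPrime›.mem_or_mem h2 with h3 | h3
    · exact Ideal.mem_primeCompl_iff.mp s.2 ((hφ s).mp ((‹Q.IsPrime›.pow_mem_iff_mem p hp.out.pos).mp h3))
    · exact hb h3
  -- hence `g ∉ K O' + 𝔪'²`; but `g = s^p (b - c'^p)` lies there
  refine not_mem_map_sup_sq_of_derivation φ q Q hQ D K hKq hK _ hDg (O' := O') ?_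
  rw [hkey]
  exact Ideal.mul_mem_left _ _ h

/-! ## §1 Abstract chart data: births are tangency points -/

section AbstractChart

variable {R : Type u} [CommRing R] [IsRegularLocalRing R] {d : ℕ} (t : Fin d → R) (j : Fin d)
  (hspan : Ideal.span (Set.range t) = maximalIdeal R) (hdim : ringKrullDim R = (d : WithBot ℕ∞))
  {A : Type u} [CommRing A] (ψ : R →+* A) (uA : Fin d → A)
  (hrel : ∀ i, ψ (t i) = ψ (t j) * uA i) (hnzd : ψ (t j) ∈ nonZeroDivisors A)
  (ε : MvPolynomial {i : Fin d // i ≠ j} (R ⧸ Ideal.span (Set.range t)) ≃+* A ⧸ Ideal.span {ψ (t j)})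
  (hεC : ∀ r : R, ε (C (Ideal.Quotient.mk (Ideal.span (Set.range t)) r)) = Ideal.Quotient.mk _ (ψ r))
  (hεX : ∀ i : {i : Fin d // i ≠ j}, ε (X i) = Ideal.Quotient.mk _ (uA i.1))
  (𝔓 : Ideal A) [𝔓.IsPrime] (h𝔓 : 𝔓.comap ψ = maximalIdeal R)
  (L : Type u) [CommRing L] [IsLocalRing L] [Algebra A L] [IsLocalization.AtPrime L 𝔓]
  (p : ℕ) [hp : Fact p.Prime]

include hspan hεC h𝔓 in
/-- **A tangent derivation not killing the unit forbids the birth** (chart form).  `N = (ψ t_j, L_y)` with `L_y ∈ 𝔓`; a derivation `D` of the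
exceptional chart `κ[T_i]_{i ≠ j}`, a prime `Q` over `𝔓`, `D` tangent to the near line at the point (`D(L̄_y) ∈ Q`) and `D(b̄) ∉ Q` for `b ∈ A`:
then `b - c'^p ∉ N L + 𝔪_L²` for every `c' ∈ L`. [cite: StacksProject, Tag 07PF] [cite: CossartPiltant2008, Lemma 4.3 (5)] -/
theorem sub_pow_not_mem_nearLine_sup_sq_of_derivation [CharP R p] {Ly : A} (hLy : Ly ∈ 𝔓)
    (Q : Ideal (MvPolynomial {i : Fin d // i ≠ j} (R ⧸ Ideal.span (Set.range t)))) [Q.IsPrime]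
    (hQ : Q.comap (ε.symm.toRingHom.comp (Ideal.Quotient.mk (Ideal.span {ψ (t j)}))) = 𝔓)
    (D : Derivation ℤ (MvPolynomial {i : Fin d // i ≠ j} (R ⧸ Ideal.span (Set.range t))) (MvPolynomial {i : Fin d // i ≠ j} (R ⧸ Ideal.span (Set.range t))))
    (hDL : D ((ε.symm.toRingHom.comp (Ideal.Quotient.mk (Ideal.span {ψ (t j)}))) Ly) ∈ Q) (b : A)
    (hDb : D ((ε.symm.toRingHom.comp (Ideal.Quotient.mk (Ideal.span {ψ (t j)}))) b) ∉ Q) (c' : L) :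
    algebraMap A L b - c' ^ p ∉ (Ideal.span {ψ (t j), Ly}).map (algebraMap A L) ⊔ maximalIdeal L ^ 2 := by
  haveI := charP_quotient_span_rsop t hspan p
  set φE := ε.symm.toRingHom.comp (Ideal.Quotient.mk (Ideal.span {ψ (t j)})) with hφE
  have hmemQ : ∀ x : A, φE x ∈ Q ↔ x ∈ 𝔓 := fun x => by rw [← hQ, Ideal.mem_comap]
  have htj𝔓 : ψ (t j) ∈ 𝔓 := map_rsop_mem_chartPrime t hspan ψ 𝔓 h𝔓 j
  have hφEt : φE (ψ (t j)) = 0 := by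
    rw [hφE, chartReduction_map t j ψ ε hεC,
      Ideal.Quotient.eq_zero_iff_mem.mpr (Ideal.subset_span ⟨j, rfl⟩ : t j ∈ Ideal.span (Set.range t)), map_zero]
  have hKle : (Ideal.span {ψ (t j), Ly} : Ideal A) ≤ 𝔓 := by
    rw [Ideal.span_le, Set.insert_subset_iff, Set.singleton_subset_iff]; exact ⟨htj𝔓, hLy⟩
  have hK : ∀ x ∈ (Ideal.span {ψ (t j), Ly} : Ideal A), D (φE x) ∈ Q := by
    intro x hx
    obtain ⟨a₁, a₂, rfl⟩ := Ideal.mem_span_pair.mp hx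
    have h2 : φE (a₁ * ψ (t j) + a₂ * Ly) = φE a₂ * φE Ly := by
      rw [map_add, map_mul, map_mul, hφEt, mul_zero, zero_add]
    rw [h2, Derivation.leibniz, smul_eq_mul, smul_eq_mul]
    exact Q.add_mem (Q.mul_mem_left _ hDL) (Q.mul_mem_right _ ((hmemQ _).mpr hLy))
  exact sub_pow_not_mem_map_sup_sq_of_derivation φE p 𝔓 Q hQ D (Ideal.span {ψ (t j), Ly}) hKle hK b hDb c'

include hspan hdim hnzd hεC hεX h𝔓 in
/-- **No birth ⟹ clean-permissible** (chart form): under the hypotheses of `sub_pow_not_mem_nearLine_sup_sq_of_derivation` with `b ∉ 𝔓`,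
`(ψ t_j, L_y, z')` a regular system of parameters of the `3`-dimensional `L` read in `F'` by `f'`, a line with representative `f'(b) · dd^p`
is clean-permissible at `L` for `N = (ψ t_j, L_y)`. [cite: Piltant2013, §2 Axiom 4] [cite: CossartPiltant2008, Lemma 4.3 (5)] -/
theorem cleanPermissibleAt_nearLine_of_derivation [IsNoetherianRing A] [CharP R p] {F' : Type u} [Field F'] [CharP F' p] (f' : L →+* F')
    (hdimL : ringKrullDim L = 3) {Ly : A} (hLy : Ly ∈ 𝔓) {z' : L}
    (hzz : Ideal.span ({algebraMap A L (ψ (t j)), algebraMap A L Ly, z'} : Set L) = maximalIdeal L)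
    (Q : Ideal (MvPolynomial {i : Fin d // i ≠ j} (R ⧸ Ideal.span (Set.range t)))) [Q.IsPrime]
    (hQ : Q.comap (ε.symm.toRingHom.comp (Ideal.Quotient.mk (Ideal.span {ψ (t j)}))) = 𝔓)
    (D : Derivation ℤ (MvPolynomial {i : Fin d // i ≠ j} (R ⧸ Ideal.span (Set.range t))) (MvPolynomial {i : Fin d // i ≠ j} (R ⧸ Ideal.span (Set.range t))))
    (hDL : D ((ε.symm.toRingHom.comp (Ideal.Quotient.mk (Ideal.span {ψ (t j)}))) Ly) ∈ Q) {b : A} (hb : b ∉ 𝔓)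
    (hDb : D ((ε.symm.toRingHom.comp (Ideal.Quotient.mk (Ideal.span {ψ (t j)}))) b) ∉ Q)
    {G : F'} (cc : Fin p → F') (hcc : ∃ i : Fin p, (i : ℕ) ≠ 0 ∧ cc i ≠ 0) {dd : F'} (hdd : dd ≠ 0)
    (hrep : (∑ i : Fin p, cc i ^ p * G ^ (i : ℕ)) = f' (algebraMap A L b) * dd ^ p) :
    CleanPermissibleAt p f' G (Ideal.span ({algebraMap A L (ψ (t j)), algebraMap A L Ly} : Set L)) := by
  have hL : IsRegularLocalRing L :=
    isRegularLocalRing_chart t j Fin.elim0 (span_range_append_elim0 t hspan) (spanFinrank_eq_add_zero hdim) L ψ uA hnzd ε hεC hεX 𝔓 h𝔓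
  have hbU : IsUnit (algebraMap A L b) := IsLocalization.map_units L (⟨b, hb⟩ : 𝔓.primeCompl)
  have hN : (Ideal.span {ψ (t j), Ly} : Ideal A).map (algebraMap A L) = Ideal.span {algebraMap A L (ψ (t j)), algebraMap A L Ly} := by
    rw [Ideal.map_span, Set.image_pair]
  by_cases h : ∃ c' : L, algebraMap A L b - c' ^ p ∈ maximalIdeal L
  · obtain ⟨c', hc'⟩ := h
    have h2 := sub_pow_not_mem_nearLine_sup_sq_of_derivation t j hspan ψ ε hεC 𝔓 h𝔓 L p hLy Q hQ D hDL b hDb c'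
    rw [hN] at h2
    exact cleanPermissibleAt_of_unit_rep_of_transversal f' hL hdimL hzz cc hcc hdd hrep hc' h2
  · push Not at h
    exact cleanPermissibleAt_of_unit_rep_of_forall f' hL hdimL hzz cc hcc hbU hdd hrep h

/-! ## §2 The explicit tangent derivation for a monomial unit -/

include hspan hrel hnzd hεC hεX h𝔓 in
/-- **THE EXPLICIT BIRTH TEST (no side through the point).**  `b = ψ(u) · ∏_k u_k^{a_k}` (a unit at `𝔓`: every `u_k` with `a_k ≠ 0` a unit),
near line `N = (ψ t_j, L_y)`, `L_y = Σ_k ψ(m_k) u_k ∈ 𝔓`, two indices `k₁ ≠ k₂` different from `j`.  If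
`a_{k₁} · ψ(m_{k₂}) u_{k₂} - a_{k₂} · ψ(m_{k₁}) u_{k₁} ∉ 𝔓`, then `b - c'^p ∉ N L + 𝔪_L²` for every `c'` — no birth at this point
(the tangent derivation `D = m̄_{k₂}T_{k₂} · T_{k₁}∂_{k₁} - m̄_{k₁}T_{k₁} · T_{k₂}∂_{k₂}` has `D L̄_y = 0` and `D b̄ = (a_{k₁} m̄_{k₂} T_{k₂} - a_{k₂} m̄_{k₁} T_{k₁}) b̄`).
[cite: StacksProject, Tag 07PF] [cite: CossartPiltant2008, Lemma 4.3 (5)] -/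
theorem sub_pow_not_mem_nearLine_sup_sq_of_cross [CharP R p] (m : Fin d → R) (hLy : (∑ k, ψ (m k) * uA k) ∈ 𝔓)
    {u : R} (a : Fin d → ℕ) (hb : ψ u * ∏ k, uA k ^ a k ∉ 𝔓) (k₁ k₂ : Fin d) (hk₁ : k₁ ≠ j) (hk₂ : k₂ ≠ j) (hk : k₁ ≠ k₂)
    (hcross : (a k₁ : A) * (ψ (m k₂) * uA k₂) - (a k₂ : A) * (ψ (m k₁) * uA k₁) ∉ 𝔓) (c' : L) :
    algebraMap A L (ψ u * ∏ k, uA k ^ a k) - c' ^ p ∉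
      (Ideal.span {ψ (t j), ∑ k, ψ (m k) * uA k}).map (algebraMap A L) ⊔ maximalIdeal L ^ 2 := by
  classical
  have hP : 𝔓.IsPrime := ‹_›
  haveI : (Ideal.span (Set.range t)).IsMaximal := isMaximal_span_rsop t hspan
  set κ := R ⧸ Ideal.span (Set.range t) with hκ
  set P := MvPolynomial {i : Fin d // i ≠ j} κ with hPdef
  set φE := ε.symm.toRingHom.comp (Ideal.Quotient.mk (Ideal.span {ψ (t j)})) with hφE
  obtain ⟨Q, hQprime, hQ⟩ := exists_prime_comap_chartReduction t j hspan ψ ε 𝔓 h𝔓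
  haveI := hQprime
  have hmemQ : ∀ x : A, φE x ∈ Q ↔ x ∈ 𝔓 := fun x => by rw [← hQ, Ideal.mem_comap]
  have huj : uA j = 1 := chartFrac_self t j ψ uA hrel hnzd
  -- reductions of the fractions: `ū_k := φE (u_k)` (`= T_k` for `k ≠ j`, `= 1` for `k = j`)
  let k₁' : {i : Fin d // i ≠ j} := ⟨k₁, hk₁⟩
  let k₂' : {i : Fin d // i ≠ j} := ⟨k₂, hk₂⟩
  have hk' : k₁' ≠ k₂' := fun h => hk (congrArg Subtype.val h)
  -- the tangent derivation: `D X_{k₁} = m̄_{k₂} T_{k₂} · X_{k₁}`, `D X_{k₂} = - m̄_{k₁} T_{k₁} · X_{k₂}`, `D X_i = 0` otherwise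
  let β : {i : Fin d // i ≠ j} → P := fun i =>
    if i = k₁' then φE (ψ (m k₂) * uA k₂) else if i = k₂' then -φE (ψ (m k₁) * uA k₁) else 0
  obtain ⟨D, hDC, hDX⟩ := MvPolynomial.exists_derivation_C_eq_X_eq (σ := {i : Fin d // i ≠ j}) (T := P) (0 : Derivation ℤ κ P)
    (fun i => β i * X i)
  have hDψ : ∀ r : R, D (φE (ψ r)) = 0 := fun r => by
    rw [hφE, chartReduction_map t j ψ ε hεC, hDC]; rfl
  -- eigen-values of `D` on the reductions of all `u_k`
  let bb : Fin d → P := fun k => if k = k₁ then φE (ψ (m k₂) * uA k₂) else if k = k₂ then -φE (ψ (m k₁) * uA k₁) else 0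
  have hDu : ∀ k : Fin d, D (φE (uA k)) = bb k * φE (uA k) := by
    intro k
    by_cases hkj : k = j
    · have h1 : k ≠ k₁ := fun h => hk₁ (h ▸ hkj)
      have h2 : k ≠ k₂ := fun h => hk₂ (h ▸ hkj)
      simp only [bb, h1, h2, if_false, zero_mul]
      rw [hkj, huj, map_one, Derivation.map_one_eq_zero]
    · rw [hφE, chartReduction_frac t j ψ uA ε hεX ⟨k, hkj⟩, hDX]
      by_cases h1 : k = k₁
      · subst h1
        simp [β, bb, k₁']
      · by_cases h2 : k = k₂
        · subst h2
          have hne : (⟨k, hkj⟩ : {i : Fin d // i ≠ j}) ≠ k₁' := fun h => h1 (congrArg Subtype.val h)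
          simp [β, bb, hne, k₂', h1]
        · have hne1 : (⟨k, hkj⟩ : {i : Fin d // i ≠ j}) ≠ k₁' := fun h => h1 (congrArg Subtype.val h)
          have hne2 : (⟨k, hkj⟩ : {i : Fin d // i ≠ j}) ≠ k₂' := fun h => h2 (congrArg Subtype.val h)
          simp [β, bb, hne1, hne2, h1, h2]
  -- `D L̄_y = 0`
  have hDL : D (φE (∑ k, ψ (m k) * uA k)) ∈ Q := by
    have h1 : D (φE (∑ k, ψ (m k) * uA k)) = ∑ k, φE (ψ (m k)) * (bb k * φE (uA k)) := by
      rw [map_sum, map_sum]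
      refine Finset.sum_congr rfl fun k _ => ?_
      rw [map_mul, Derivation.leibniz, smul_eq_mul, smul_eq_mul, hDψ, mul_zero, add_zero, hDu]
    have h2 : ∑ k, φE (ψ (m k)) * (bb k * φE (uA k)) = 0 := by
      rw [Finset.sum_eq_add k₁ k₂ hk (fun k _ hkk => by simp [bb, hkk.1, hkk.2]) (fun h => absurd (Finset.mem_univ _) h)
        (fun h => absurd (Finset.mem_univ _) h)]
      simp only [bb, if_true, if_neg hk.symm, map_mul]
      ring
    rw [h1, h2]
    exact Q.zero_mem
  -- `D b̄ = (a_{k₁} m̄_{k₂} T_{k₂} - a_{k₂} m̄_{k₁} T_{k₁}) b̄ ∉ Q`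
  have hDb : D (φE (ψ u * ∏ k, uA k ^ a k)) ∉ Q := by
    have h1 : D (φE (ψ u * ∏ k, uA k ^ a k)) = (∑ k, (a k : P) * bb k) * φE (ψ u * ∏ k, uA k ^ a k) := by
      rw [map_mul, map_prod]
      simp only [map_pow]
      exact derivation_apply_mul_prod_pow_eq_sum_mul D (fun k => φE (uA k)) bb a hDu (hDψ u)
    have h2 : ∑ k, (a k : P) * bb k = φE ((a k₁ : A) * (ψ (m k₂) * uA k₂) - (a k₂ : A) * (ψ (m k₁) * uA k₁)) := by
      rw [Finset.sum_eq_add k₁ k₂ hk (fun k _ hkk => by simp [bb, hkk.1, hkk.2]) (fun h => absurd (Finset.mem_univ _) h)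
        (fun h => absurd (Finset.mem_univ _) h)]
      simp only [bb, if_true, if_neg hk.symm, map_sub, map_mul, map_natCast]
      ring
    rw [h1, h2]
    intro h3
    rcases hQprime.mem_or_mem h3 with h4 | h4
    · exact hcross ((hmemQ _).mp h4)
    · exact hb ((hmemQ _).mp h4)
  exact sub_pow_not_mem_nearLine_sup_sq_of_derivation t j hspan ψ ε hεC 𝔓 h𝔓 L p hLy Q hQ D hDL _ hDb c'

include hspan hrel hnzd hεC hεX h𝔓 in
/-- **The explicit birth test, read in `L`** (`sub_pow_not_mem_nearLine_sup_sq_of_cross` with the images expanded: the unit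
`ψ(u) · ∏_k u_k^{a_k}` and the near line `(ψ t_j, Σ_k ψ(m_k) u_k)` as elements / an ideal of `L`; the form the scheme-level packaging reads
through a chart presentation `χ`). [cite: StacksProject, Tag 07PF] [cite: CossartPiltant2008, Lemma 4.3 (5)] -/
theorem sub_pow_not_mem_nearLine_sup_sq_of_cross' [CharP R p] (m : Fin d → R) (hLy : (∑ k, ψ (m k) * uA k) ∈ 𝔓)
    {u : R} (a : Fin d → ℕ) (hb : ψ u * ∏ k, uA k ^ a k ∉ 𝔓) (k₁ k₂ : Fin d) (hk₁ : k₁ ≠ j) (hk₂ : k₂ ≠ j) (hk : k₁ ≠ k₂)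
    (hcross : (a k₁ : A) * (ψ (m k₂) * uA k₂) - (a k₂ : A) * (ψ (m k₁) * uA k₁) ∉ 𝔓) (c' : L) :
    algebraMap A L (ψ u) * ∏ k, algebraMap A L (uA k) ^ a k - c' ^ p ∉
      Ideal.span {algebraMap A L (ψ (t j)), ∑ k, algebraMap A L (ψ (m k)) * algebraMap A L (uA k)} ⊔ maximalIdeal L ^ 2 := by
  have h := sub_pow_not_mem_nearLine_sup_sq_of_cross t j hspan ψ uA hrel hnzd ε hεC hεX 𝔓 h𝔓 L p m hLy a hb k₁ k₂ hk₁ hk₂ hk hcross c'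
  rw [Ideal.map_span, Set.image_pair, map_sum, map_mul, map_prod] at h
  simp only [map_mul, map_pow] at h
  exact h

end AbstractChart

end Summit.ResolutionOfSingularities.ResolutionOfSingularities.Theorems.RadicialJung.CleanModels

end
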